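import Mathlib.MeasureTheory.Integral.MeanInequalities
import Mathlib.MeasureTheory.Measure.Prod
import HarnessLib

/-!
# Route `BECCutLineWeakDisorder`, crux `TwoReplicaTransienceBound` (stmt-AtomisticToContinuum-9687):
# the participation ratio of a kernel mixture (line `SketchIdeator1`, tracer decoupling — toolbox)

Pure measure theory, used by the quenched-profile form of the line's engine `TracerProfileBound`
(`Theorems/BECCutLineWeakDisorderDefs.lean`). The engine bounds the mean of the *participation ratio*
`PR(g) = |Λ| ∫ g² / (∫ g)²` of the passive tracer's survival profile `x ↦ g_T(x, ω)`. By the Markov property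
of the tagged line at an intermediate time `t ≤ T`, that profile is a MIXTURE `x ↦ ∫ k_t^ω(x, y) f(y) dy` of
the profiles of the quenched killed kernel with nonnegative weights `f` (the future survival from `y`).
The lemma of this file is the deterministic step that makes the late times `T ≥ t` harmless for the
quenched engine (the common late-time factor sits in `f` and cancels):

* `lintegral_sq_lintegral_mul_le_sq` — Minkowski in `L²` for nonnegative kernels, Gram form:
  `∫ₓ (∫_y k(x,y) f(y))² ≤ (∫_y f(y) ‖k(·,y)‖₂)²`;
* `mixture_participation_le` — **the participation ratio of a mixture is at most the worst component's**:
  `‖∫ k(·,y) f(y) dy‖₂² / ‖∫ k(·,y) f(y) dy‖₁² ≤ sup_y ‖k(·,y)‖₂² / ‖k(·,y)‖₁²`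
  (all in `[0, ∞]`, `x/0`, `x/∞` conventions of `ENNReal`; s-finite measures, jointly measurable kernel).

References: G. H. Hardy, J. E. Littlewood, G. Pólya, *Inequalities* (1952), Thm 202 (Minkowski's integral
inequality); the mediant inequality.
-/

noncomputable section

namespace Summit.AtomisticToContinuum.BoseEinsteinCondensation.Cruxes.TwoReplicaTransienceBound.TracerDecoupling

open MeasureTheory
open scoped ENNReal

variable {α β : Type*} [MeasurableSpace α] [MeasurableSpace β]

/-- Cauchy–Schwarz for `[0, ∞]`-valued functions with square roots written as `rpow (1/2)`:
`∫ g h ≤ (∫ g²)^{1/2} (∫ h²)^{1/2}`. -/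
theorem lintegral_mul_le_sqrt_mul_sqrt (μ : Measure α) {g h : α → ℝ≥0∞} (hg : AEMeasurable g μ)
    (hh : AEMeasurable h μ) :
    ∫⁻ x, g x * h x ∂μ ≤ (∫⁻ x, g x ^ 2 ∂μ) ^ (1 / 2 : ℝ) * (∫⁻ x, h x ^ 2 ∂μ) ^ (1 / 2 : ℝ) := by
  have := ENNReal.lintegral_mul_le_Lp_mul_Lq μ Real.HolderConjugate.two_two hg hh
  simpa only [Pi.mul_apply, ENNReal.rpow_two] using this

/-- **Minkowski in `L²` for a nonnegative kernel (Gram form).** For s-finite `μ, ν`, a jointly measurable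
kernel `k ≥ 0` and measurable weights `f ≥ 0`:
`∫ₓ (∫_y k(x,y) f(y) dν)² dμ ≤ (∫_y f(y) · (∫ₓ k(x,y)² dμ)^{1/2} dν)²`
(expand the square as a double integral, Tonelli, Cauchy–Schwarz in `x` for each pair `(y, y')`). -/
theorem lintegral_sq_lintegral_mul_le_sq {μ : Measure α} {ν : Measure β} [SFinite μ] [SFinite ν]
    {k : α → β → ℝ≥0∞} (hk : Measurable (Function.uncurry k)) {f : β → ℝ≥0∞} (hf : Measurable f) :
    ∫⁻ x, (∫⁻ y, k x y * f y ∂ν) ^ 2 ∂μ ≤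
      (∫⁻ y, f y * (∫⁻ x, k x y ^ 2 ∂μ) ^ (1 / 2 : ℝ) ∂ν) ^ 2 := by
  set a : β → ℝ≥0∞ := fun y => (∫⁻ x, k x y ^ 2 ∂μ) ^ (1 / 2 : ℝ) with ha
  -- measurability bookkeeping
  have hF : Measurable (Function.uncurry fun x y => k x y * f y) := hk.mul (hf.comp measurable_snd)
  have hFx : ∀ x, Measurable fun y => k x y * f y := fun x => hF.comp measurable_prodMk_left
  have hky : ∀ y, Measurable fun x => k x y := fun y => hk.comp measurable_prodMk_right
  have ha_meas : Measurable a := by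
    have h2 : Measurable fun p : α × β => k p.1 p.2 ^ 2 := hk.pow_const 2
    exact (h2.lintegral_prod_left').pow_const _
  have hfa : Measurable fun y => f y * a y := hf.mul ha_meas
  -- step 1: the square of the inner integral as a double integral
  have h1 : ∀ x, (∫⁻ y, k x y * f y ∂ν) ^ 2 =
      ∫⁻ y, ∫⁻ y', (k x y * f y) * (k x y' * f y') ∂ν ∂ν := fun x => by
    rw [sq, lintegral_lintegral_mul (hFx x).aemeasurable (hFx x).aemeasurable]
  simp_rw [h1]
  -- step 2: move the `x`-integral inside (two Tonelli swaps)
  have hG : Measurable (Function.uncurry fun (x : α) (y : β) =>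
      ∫⁻ y', (k x y * f y) * (k x y' * f y') ∂ν) := by
    have : Measurable (Function.uncurry fun (p : α × β) (y' : β) =>
        (k p.1 p.2 * f p.2) * (k p.1 y' * f y')) :=
      (hF.comp measurable_fst).mul (hF.comp (measurable_fst.fst.prodMk measurable_snd))
    exact this.lintegral_prod_right'
  have h2 : ∫⁻ x, ∫⁻ y, ∫⁻ y', (k x y * f y) * (k x y' * f y') ∂ν ∂ν ∂μ =
      ∫⁻ y, ∫⁻ y', ∫⁻ x, (k x y * f y) * (k x y' * f y') ∂μ ∂ν ∂ν := by
    rw [lintegral_lintegral_swap hG.aemeasurable]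
    refine lintegral_congr fun y => ?_
    have hH : Measurable (Function.uncurry fun (x : α) (y' : β) => (k x y * f y) * (k x y' * f y')) :=
      (((hky y).mul measurable_const).comp measurable_fst).mul hF
    rw [lintegral_lintegral_swap hH.aemeasurable]
  rw [h2]
  -- step 3: Cauchy–Schwarz in `x` for each pair `(y, y')`
  have h3 : ∀ y y', ∫⁻ x, (k x y * f y) * (k x y' * f y') ∂μ ≤ (f y * a y) * (f y' * a y') := by
    intro y y'
    have hcs := lintegral_mul_le_sqrt_mul_sqrt μ (hky y).aemeasurable (hky y').aemeasurable
    calc ∫⁻ x, (k x y * f y) * (k x y' * f y') ∂μ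
        = ∫⁻ x, (f y * f y') * (k x y * k x y') ∂μ := lintegral_congr fun x => by ring
      _ = (f y * f y') * ∫⁻ x, k x y * k x y' ∂μ :=
          lintegral_const_mul _ ((hky y).mul (hky y'))
      _ ≤ (f y * f y') * (a y * a y') := mul_le_mul' le_rfl hcs
      _ = (f y * a y) * (f y' * a y') := by ring
  -- step 4: reassemble the square
  calc ∫⁻ y, ∫⁻ y', ∫⁻ x, (k x y * f y) * (k x y' * f y') ∂μ ∂ν ∂ν
      ≤ ∫⁻ y, ∫⁻ y', (f y * a y) * (f y' * a y') ∂ν ∂ν :=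
        lintegral_mono fun y => lintegral_mono fun y' => h3 y y'
    _ = (∫⁻ y, f y * a y ∂ν) ^ 2 := by
        rw [lintegral_lintegral_mul hfa.aemeasurable hfa.aemeasurable, sq]

/-- **The participation ratio of a mixture is at most the worst component's** (mediant + Minkowski).
For s-finite `μ, ν`, a jointly measurable kernel `k ≥ 0` and measurable weights `f ≥ 0`,
`‖∫ k(·,y)f(y)dν‖²_{L²(μ)} / ‖∫ k(·,y)f(y)dν‖²_{L¹(μ)} ≤ ⨆_y ‖k(·,y)‖²_{L²(μ)} / ‖k(·,y)‖²_{L¹(μ)}` in `[0,∞]`.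
(Application: with `μ` = Lebesgue on `Λ_L`, `k = k_t^ω` the quenched killed kernel of the tagged line at an
intermediate time `t` and `f` its future survival, `|Λ| ×` the left side is the participation ratio of the
tracer profile `g_T(·,ω)` for every `T ≥ t`.) -/
theorem mixture_participation_le {μ : Measure α} {ν : Measure β} [SFinite μ] [SFinite ν]
    {k : α → β → ℝ≥0∞} (hk : Measurable (Function.uncurry k)) {f : β → ℝ≥0∞} (hf : Measurable f) :
    (∫⁻ x, (∫⁻ y, k x y * f y ∂ν) ^ 2 ∂μ) / (∫⁻ x, ∫⁻ y, k x y * f y ∂ν ∂μ) ^ 2 ≤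
      ⨆ y, (∫⁻ x, k x y ^ 2 ∂μ) / (∫⁻ x, k x y ∂μ) ^ 2 := by
  set A : β → ℝ≥0∞ := fun y => ∫⁻ x, k x y ^ 2 ∂μ with hA
  set b : β → ℝ≥0∞ := fun y => ∫⁻ x, k x y ∂μ with hb
  set M : ℝ≥0∞ := ⨆ y, A y / b y ^ 2 with hM
  set D : ℝ≥0∞ := ∫⁻ x, ∫⁻ y, k x y * f y ∂ν ∂μ with hDdef
  have hF : Measurable (Function.uncurry fun x y => k x y * f y) := hk.mul (hf.comp measurable_snd)
  have hky : ∀ y, Measurable fun x => k x y := fun y => hk.comp measurable_prodMk_right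
  have hb_meas : Measurable b := hk.lintegral_prod_left'
  -- Tonelli: `D = ∫ f b`
  have hD : D = ∫⁻ y, f y * b y ∂ν := by
    rw [hDdef, lintegral_lintegral_swap hF.aemeasurable]
    refine lintegral_congr fun y => ?_
    rw [lintegral_mul_const _ (hky y), mul_comm]
  -- the Gram/Minkowski bound on the numerator
  have hnum := lintegral_sq_lintegral_mul_le_sq (μ := μ) (ν := ν) hk hf
  -- pointwise: `‖k(·,y)‖₂ ≤ M^{1/2} ‖k(·,y)‖₁` whenever `‖k(·,y)‖₁ < ∞`
  have hpt : ∀ y, b y ≠ ⊤ → A y ^ (1 / 2 : ℝ) ≤ M ^ (1 / 2 : ℝ) * b y := by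
    intro y hbt
    rcases eq_or_ne (b y) 0 with hb0 | hb0
    · have hae : (fun x => k x y) =ᵐ[μ] 0 := (lintegral_eq_zero_iff (hky y)).1 hb0
      have hA0 : A y = 0 := by
        refine (lintegral_eq_zero_iff ((hky y).pow_const 2)).2 ?_
        filter_upwards [hae] with x hx
        simp [hx]
      rw [hA0, ENNReal.zero_rpow_of_pos (by norm_num)]
      exact bot_le
    · have hle : A y / b y ^ 2 ≤ M := le_iSup (fun y => A y / b y ^ 2) y
      have hb2 : b y ^ 2 ≠ 0 := pow_ne_zero _ hb0
      have hb2t : b y ^ 2 ≠ ⊤ := ENNReal.pow_ne_top hbt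
      have hAle : A y ≤ M * b y ^ 2 := (ENNReal.div_le_iff_le_mul (Or.inl hb2) (Or.inl hb2t)).1 hle
      calc A y ^ (1 / 2 : ℝ) ≤ (M * b y ^ 2) ^ (1 / 2 : ℝ) := ENNReal.rpow_le_rpow hAle (by norm_num)
        _ = M ^ (1 / 2 : ℝ) * b y := by
            have hsq : (b y ^ 2) ^ (1 / 2 : ℝ) = b y := by
              rw [← ENNReal.rpow_natCast, ← ENNReal.rpow_mul]
              norm_num
            rw [ENNReal.mul_rpow_of_nonneg _ _ (by norm_num), hsq]
  -- the degenerate total mass `D = ∞`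
  by_cases hDt : D = ⊤
  · rw [hDt, ENNReal.top_pow two_ne_zero, ENNReal.div_top]
    exact bot_le
  -- a.e. in `y`: `f(y) = 0` or `‖k(·,y)‖₁ < ∞`
  have hfb : ∀ᵐ y ∂ν, f y * b y < ⊤ := by
    refine ae_lt_top (hf.mul hb_meas) ?_
    rwa [← hD]
  have hfb_meas : Measurable fun y => f y * b y := hf.mul hb_meas
  have hfa_le : ∫⁻ y, f y * A y ^ (1 / 2 : ℝ) ∂ν ≤ M ^ (1 / 2 : ℝ) * D := by
    calc ∫⁻ y, f y * A y ^ (1 / 2 : ℝ) ∂ν ≤ ∫⁻ y, M ^ (1 / 2 : ℝ) * (f y * b y) ∂ν := by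
          refine lintegral_mono_ae ?_
          filter_upwards [hfb] with y hy
          rcases eq_or_ne (f y) 0 with hf0 | hf0
          · simp [hf0]
          · have hbt : b y ≠ ⊤ := by
              intro h
              rw [h, ENNReal.mul_top hf0] at hy
              exact lt_irrefl _ hy
            calc f y * A y ^ (1 / 2 : ℝ) ≤ f y * (M ^ (1 / 2 : ℝ) * b y) :=
                  mul_le_mul' le_rfl (hpt y hbt)
              _ = M ^ (1 / 2 : ℝ) * (f y * b y) := by ring
      _ = M ^ (1 / 2 : ℝ) * ∫⁻ y, f y * b y ∂ν := lintegral_const_mul _ hfb_meas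
      _ = M ^ (1 / 2 : ℝ) * D := by rw [hD]
  have hnum' : ∫⁻ x, (∫⁻ y, k x y * f y ∂ν) ^ 2 ∂μ ≤ M * D ^ 2 := by
    calc ∫⁻ x, (∫⁻ y, k x y * f y ∂ν) ^ 2 ∂μ
        ≤ (∫⁻ y, f y * A y ^ (1 / 2 : ℝ) ∂ν) ^ 2 := hnum
      _ ≤ (M ^ (1 / 2 : ℝ) * D) ^ 2 := by gcongr
      _ = M * D ^ 2 := by
          have hsq : (M ^ (1 / 2 : ℝ)) ^ 2 = M := by
            rw [← ENNReal.rpow_natCast, ← ENNReal.rpow_mul]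
            norm_num
          rw [mul_pow, hsq]
  rcases eq_or_ne D 0 with hD0 | hD0
  · have h0 : ∫⁻ x, (∫⁻ y, k x y * f y ∂ν) ^ 2 ∂μ = 0 :=
      le_antisymm (by simpa [hD0] using hnum') bot_le
    rw [h0, ENNReal.zero_div]
    exact bot_le
  · exact (ENNReal.div_le_iff_le_mul (Or.inl (pow_ne_zero _ hD0))
      (Or.inl (ENNReal.pow_ne_top hDt))).2 hnum'

/-- **Registered toolbox stub `stub_mixtureParticipation`** (crux stmt-AtomisticToContinuum-9687, line
`SketchIdeator1`): the participation ratio of a kernel mixture is at most the worst component's, in the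
registered explicit form (`Type`-level carriers; `= mixture_participation_le`). -/
theorem stub_mixtureParticipation :
    ∀ {α β : Type} [MeasurableSpace α] [MeasurableSpace β] (μ : MeasureTheory.Measure α)
      (ν : MeasureTheory.Measure β) [MeasureTheory.SFinite μ] [MeasureTheory.SFinite ν]
      (k : α → β → ENNReal), Measurable (Function.uncurry k) → ∀ (f : β → ENNReal), Measurable f →
        (∫⁻ x, (∫⁻ y, k x y * f y ∂ν) ^ 2 ∂μ) / (∫⁻ x, ∫⁻ y, k x y * f y ∂ν ∂μ) ^ 2 ≤
          ⨆ y, (∫⁻ x, k x y ^ 2 ∂μ) / (∫⁻ x, k x y ∂μ) ^ 2 := by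
  intro α β _ _ μ ν _ _ k hk f hf
  exact mixture_participation_le hk hf

end Summit.AtomisticToContinuum.BoseEinsteinCondensation.Cruxes.TwoReplicaTransienceBound.TracerDecoupling

end
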